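import Mathlib
import Literature.Analysis.FluidPDE.TypeIAncientMild
import Literature.Analysis.FluidPDE.SpaceTimeCalculus
import Summits.NavierStokesRegularity.NavierStokesRegularity.Theses.SymmetryModuliCount
import Summits.NavierStokesRegularity.NavierStokesRegularity.Theorems.SymmetryModuliCountForcedSymmetryInteriorVertexVanishing
import Literature.Analysis.FluidPDE.TypeIAncientMildRssPullback
import Summits.NavierStokesRegularity.NavierStokesRegularity.Theorems.SymmetryModuliCountSymmetricLiouvilleRotationCovariance
import Summits.NavierStokesRegularity.NavierStokesRegularity.Theorems.SqueezeCycleExtremalElementExistsRescale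
import HarnessLib

/-!
# Route SymmetryModuliCount — future-vertex soliton Liouville, rotated leaf (`A ≠ 0`):
# conditional reduction to the sibling crux `SymmetricLiouville`

Theorems file serving the crux item stmt-NavierStokesRegularity-4052
(`Summit.NavierStokesRegularity.NavierStokesRegularity.Theses.SymmetryModuliCount.ForcedSymmetry`),
line `time-anchor-bootstrap`, registered stub 2b `stub_futureVertexLiouvilleRotated`:

* a Type-I KNSS-mild ancient field `u ∈ A_C` (`IsTypeIAncientMild C u`) on `(-∞, 0) × ℝ³` which
  is annihilated on `t < 0` by a ROTATED scaling generator about a FUTURE vertex `(θ, x_c)`,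
  `θ > 0` — `∇u·(a + σx + Ax) + σu + 2σ(t − θ)∂ₜu − Au = 0`, `A ≠ 0` skew, `σ ≠ 0` — i.e. an
  exactly backward rotated-self-similar field about a blow-up point in the future of the slab,
  with merely BOUNDED profile, vanishes.

**Status: OPEN IN PRINT.** Pineau–Vicol (arXiv:2607.09619), Thm. 1.4 (tree fact
`pineauVicol2026_rss_liouville`) proves rotated-self-similar Liouville only under the space–time
bound `‖u‖ ≤ C₀/(‖x‖ + √(−t))` (profile decaying like `1/|y|`) and only for rotation rates
`|α| < α₁(C₀)` or `|α| > α₂(C₀)`; bounded profiles at every `α ≠ 0` are their Conjecture 1.1 =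
Tsai 2018, Conj. 8.9, a fortiori. This file does NOT prove the stub. It proves the stub
**conditionally on the sibling crux** `SymmetricLiouville` (stmt-NavierStokesRegularity-4053),
whose rotated-self-similar sub-case (`Cruxes/SymmetricLiouville/Disproof.lean`,
`RotatedSelfSimilarLiouville`) is exactly this open statement anchored at vertex time `0`.

## The reduction (`rss_futureVertexLiouvilleRotated_of_symmetricLiouville`)

`SymmetricLiouville` kills members of `A_C` annihilated on the WHOLE slab by a generator anchored
at vertex time `0`; the stub's generator is anchored at `θ > 0`. Backward time-shifts (which
preserve `A_C`) move the vertex further into the future, so one must shift FORWARD,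
`v(s, ·) = u(s + θ, ·)`, which is only defined for `s < −θ`, and EXTEND `v` to `s < 0`. Rotated
Euler homogeneity (`rss_pull_const`, toolkit `Literature/…/FluidPDE/TypeIAncientMildRssPullback.lean`)
does it: with `x_c` the centre (`σx_c + Ax_c = −a`) and `B = σ⁻¹A`, the pull-backs
`P_ρ u (s, y) = e^ρ e^{−ρB} u(θ + e^{2ρ}s, x_c + e^ρ e^{ρB}(y − x_c))` do not depend on `ρ` as long
as `θ + e^{2ρ}s < 0`, so `ṽ(s, y) := P_{ρ(s)} u (s, y)`, `ρ(s) = log √((θ+1)/(−s))`, is a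
well-defined field on `s < 0` which agrees with `P_ρ u` wherever the latter looks into the slab.
Now `P_ρ u = G_ρ(· + θe^{−2ρ})` is a forward time-shift, by `θe^{−2ρ} → 0`, of the member
`G_ρ = e^{−ρB} ∘ (zoom of u by e^ρ about (0, x₀)) ∘ e^{ρB} ∈ A_C` (`rss_exists_member`: the
class is zoom covariant, `isTypeIAncientMild_zoom`, and rotation covariant,
`isTypeIAncientMild_conj_linearIsometryEquiv`), so `ṽ ∈ A_{2C}` by the gluing lemma
`rss_isTypeIAncientMild_of_local`; and `ṽ` is annihilated by the SAME generator anchored at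
vertex time `0` (`rss_ext_gen`: differentiate the exact invariance `P_r ṽ = ṽ` at `r = 0`,
`rss_hasDerivAt_pull`). `SymmetricLiouville` gives `ṽ ≡ 0`, and `u(t, ·) = ṽ(t − θ, ·) = 0`.

Only route decls and proved tree theorems are used; the result is CONDITIONAL on
`SymmetricLiouville` (hypothesis `hSL`), nothing else.

## References

* B. Pineau, V. Vicol, arXiv:2607.09619 (2026), Conj. 1.1, Thm. 1.4. [PineauVicol2026]
* T.-P. Tsai, *Lectures on Navier–Stokes equations*, GSM 192 (2018), Conj. 8.9. [Tsai2018]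
* G. Koch, N. Nadirashvili, G. Seregin, V. Šverák, Acta Math. 203 (2009) = arXiv:0709.3599, §1
  (symmetries of the class). [KochNadirashviliSereginSverak2009]
* Skeleton: `Cruxes/ForcedSymmetry/Lines/time-anchor-bootstrap.lean`, stub 2b.
-/

noncomputable section

-- the summit and its single sub-problem share the name (CONVENTIONS §1), as in every Theorems file
set_option linter.dupNamespace false

open Set Filter Topology Function
open Literature.Analysis.FluidPDE
open scoped RealInnerProductSpace

namespace Summit.NavierStokesRegularity.NavierStokesRegularity.Theorems

variable {E : Type*} [NormedAddCommGroup E] [InnerProductSpace ℝ E]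

/-- **The pull-backs are forward shifts of class members.** For `u ∈ A_C` on `ℝ³`, skew `B`,
any `θ`, `x_c` and `ρ`, the field
`G_ρ(t, x) = e^{−ρB}[(e^ρ • stPull e^{2ρ} e^ρ 0 x₀ u)(t, e^{ρB}x)]`, `x₀ = x_c − e^ρ e^{ρB}x_c`
(zoom by `e^ρ` about `(0, x₀)`, conjugated by the isometry `e^{−ρB}`) lies in `A_C`
(`isTypeIAncientMild_zoom`, `isTypeIAncientMild_conj_linearIsometryEquiv`) and
`G_ρ(s + θe^{−2ρ}, y) = P_ρ u (s, y) = e^ρ e^{−ρB} u(θ + e^{2ρ}s, x_c + e^ρ e^{ρB}(y − x_c))`. [folklore] -/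
theorem rss_exists_member {C : ℝ} {u : ℝ → EuclideanSpace ℝ (Fin 3) → EuclideanSpace ℝ (Fin 3)}
    (hu : IsTypeIAncientMild C u) {B : EuclideanSpace ℝ (Fin 3) →L[ℝ] EuclideanSpace ℝ (Fin 3)}
    (hB : ∀ x, ⟪B x, x⟫ = 0) (θ : ℝ) (xc : EuclideanSpace ℝ (Fin 3)) (ρ : ℝ) :
    ∃ G : ℝ → EuclideanSpace ℝ (Fin 3) → EuclideanSpace ℝ (Fin 3), IsTypeIAncientMild C G ∧ ∀ s y,
      G (s + θ / Real.exp ρ ^ 2) y = Real.exp ρ • NormedSpace.exp ((-ρ) • B)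
        (u (θ + Real.exp ρ ^ 2 * s) (xc + Real.exp ρ • NormedSpace.exp (ρ • B) (y - xc))) := by
  obtain ⟨L, hL, hLs⟩ := rss_exists_rot hB ρ
  have hc : 0 < Real.exp ρ := Real.exp_pos ρ
  refine ⟨fun t x => L ((Real.exp ρ • stPull (Real.exp ρ ^ 2) (Real.exp ρ) 0
      (xc - Real.exp ρ • NormedSpace.exp (ρ • B) xc) u) t (L.symm x)),
    Summit.NavierStokesRegularity.NavierStokesRegularity.Theorems.SymmetryModuliCountSymmetricLiouville.isTypeIAncientMild_conj_linearIsometryEquiv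
      (isTypeIAncientMild_zoom hu hc _) L, fun s y => ?_⟩
  have e1 : Real.exp ρ ^ 2 * (s + θ / Real.exp ρ ^ 2) = θ + Real.exp ρ ^ 2 * s := by
    field_simp
    ring
  have e2 : xc - Real.exp ρ • NormedSpace.exp (ρ • B) xc +
      Real.exp ρ • NormedSpace.exp (ρ • B) y =
      xc + Real.exp ρ • NormedSpace.exp (ρ • B) (y - xc) := by
    rw [map_sub, smul_sub]
    abel
  show L ((Real.exp ρ • stPull (Real.exp ρ ^ 2) (Real.exp ρ) 0
      (xc - Real.exp ρ • NormedSpace.exp (ρ • B) xc) u) (s + θ / Real.exp ρ ^ 2) (L.symm y)) = _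
  rw [zoom_apply, hLs, hL, map_smul, e1, e2]

/-- **The extension is annihilated by the generator anchored at vertex time `0`.** Let
`uncurry u` be differentiable on the open slab with `G_θ u = 0` there (normalised rotated
scaling generator with vertex `(θ, x_c)`, `θ > 0`), and let `v(s, y) = P_{ρ(s)} u (s, y)`,
`ρ(s) = log √((θ+1)/(−s))`. If `uncurry v` is Fréchet differentiable at `(s, y)`, `s < 0`, then
`Dv·((y − x_c) + B(y − x_c)) + v + 2s∂ₛv − Bv = 0` at `(s, y)`: the family
`r ↦ eʳe^{−rB} v(e^{2r}s, x_c + eʳe^{rB}(y − x_c))` is constant (`= v(s, y)`, by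
`rss_pull_const` and the cocycle identity `rss_pull_cocycle`), and its derivative at `r = 0` is
the displayed generator (`rss_hasDerivAt_pull` with vertex time `0`). [folklore] -/
theorem rss_ext_gen [CompleteSpace E] {u v : ℝ → E → E}
    (hd : DifferentiableOn ℝ (uncurry u) (Iio 0 ×ˢ univ)) {B : E →L[ℝ] E} {θ : ℝ} (hθ : 0 < θ)
    {xc : E}
    (hgen : ∀ t < 0, ∀ x, fderiv ℝ (u t) x ((x - xc) + B (x - xc)) + u t x +
      (2 * (t - θ)) • timeDeriv u t x - B (u t x) = 0)
    (hv : ∀ s y, v s y = Real.exp (Real.log (Real.sqrt ((θ + 1) / (-s)))) •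
      NormedSpace.exp ((-Real.log (Real.sqrt ((θ + 1) / (-s)))) • B)
        (u (θ + Real.exp (Real.log (Real.sqrt ((θ + 1) / (-s)))) ^ 2 * s)
          (xc + Real.exp (Real.log (Real.sqrt ((θ + 1) / (-s)))) •
            NormedSpace.exp (Real.log (Real.sqrt ((θ + 1) / (-s))) • B) (y - xc))))
    {s : ℝ} (hs : s < 0) {y : E} {Lv : ℝ × E →L[ℝ] E} (hLv : HasFDerivAt (uncurry v) Lv (s, y)) :
    fderiv ℝ (v s) y ((y - xc) + B (y - xc)) + v s y + (2 * s) • timeDeriv v s y - B (v s y) = 0 := by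
  obtain ⟨tc, htc⟩ : ∃ tc : ℝ → ℝ, tc = fun r => 0 + Real.exp r ^ 2 * s := ⟨_, rfl⟩
  obtain ⟨X, hX⟩ :
      ∃ X : ℝ → E, X = fun r => xc + Real.exp r • NormedSpace.exp (r • B) (y - xc) := ⟨_, rfl⟩
  have htc0 : tc 0 = s := by simp [htc]
  have hX0 : X 0 = y := by simp [hX]
  set r₀ : ℝ := Real.log (Real.sqrt ((θ + 1) / (-s))) with hr₀_def
  have hr₀ : θ + Real.exp r₀ ^ 2 * s = -1 := rss_anchor hθ hs
  -- the family `r ↦ P_r v (s, y)` (vertex time `0`) is constant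
  have hconst : ∀ r, Real.exp r • NormedSpace.exp ((-r) • B) (v (tc r) (X r)) = v s y := by
    intro r
    have her : 0 < Real.exp r ^ 2 := by positivity
    have hsr : tc r < 0 := by
      rw [htc]
      show 0 + Real.exp r ^ 2 * s < 0
      nlinarith
    have hm1 : θ + Real.exp (Real.log (Real.sqrt ((θ + 1) / (-(tc r))))) ^ 2 * tc r < 0 := by
      rw [rss_anchor hθ hsr]
      norm_num
    have hm2 : θ + Real.exp (r₀ - r) ^ 2 * tc r < 0 := by
      rw [htc]
      show θ + Real.exp (r₀ - r) ^ 2 * (0 + Real.exp r ^ 2 * s) < 0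
      rw [zero_add, ← mul_assoc, ← mul_pow, ← Real.exp_add, sub_add_cancel, hr₀]
      norm_num
    rw [hv (tc r) (X r), rss_pull_const hd hgen (X r) hm1 hm2]
    subst htc hX
    dsimp only
    rw [zero_add, rss_pull_cocycle, sub_add_cancel, hr₀_def, ← hv s y]
  -- its derivative at `r = 0` is the generator of `v` at `(s, y)`
  have hL' : HasFDerivAt (uncurry v) Lv (tc 0, X 0) := by
    rw [htc0, hX0]
    exact hLv
  have hD := rss_hasDerivAt_pull (θ := 0) htc hX hL'
  have hD0 : HasDerivAt (fun r => Real.exp r • NormedSpace.exp ((-r) • B) (v (tc r) (X r))) 0 0 := by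
    rw [show (fun r => Real.exp r • NormedSpace.exp ((-r) • B) (v (tc r) (X r))) = fun _ => v s y
      from funext hconst]
    exact hasDerivAt_const 0 _
  have huniq := hD.unique hD0
  rw [htc0, hX0] at huniq
  simpa only [Real.exp_zero, neg_zero, zero_smul, NormedSpace.exp_zero,
    one_apply_eq_self, one_smul, sub_zero] using huniq

/-- **Conditional rotated future-vertex Liouville theorem** (registered sub-goal
`rss_futureVertexLiouvilleRotated_of_symmetricLiouville` of stmt-NavierStokesRegularity-4052 =
`SymmetricLiouville → Sig.stub_futureVertexLiouvilleRotated`, stub 2b of line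
`time-anchor-bootstrap` in CONDITIONAL form). ASSUMING the sibling crux
`Summit.NavierStokesRegularity.NavierStokesRegularity.Theses.SymmetryModuliCount.SymmetricLiouville`
(item stmt-NavierStokesRegularity-4053: members of `A_C` annihilated by a nonzero similarity
generator anchored at vertex time `0` vanish) — whose relevant sub-case, rotated self-similar
fields with BOUNDED profile at every rotation rate, is OPEN IN PRINT (Pineau–Vicol 2026,
Conj. 1.1; Tsai 2018, Conj. 8.9; PV Thm. 1.4 = tree fact `pineauVicol2026_rss_liouville` needs
the space–time bound (1.10) and `|α| ≪ 1` or `≫ 1`) — every `u ∈ A_C` annihilated on `t < 0` by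
a rotated scaling generator about a FUTURE vertex (`θ > 0`, `σ ≠ 0`, `A` skew) vanishes
identically on `t < 0`. Proof: module docstring (forward shift + rotated Euler homogeneity
extension `ṽ ∈ A_{2C}`, `SymmetricLiouville` applied to `ṽ` at constant `2C`). The hypothesis
`A ≠ 0` is not used (for `A = 0` this is the irrotational leaf, proved unconditionally in
`…FutureVertexLiouvilleIrrotational.lean`); it is kept so that the conclusion is literally the
registered signature `Sig.stub_futureVertexLiouvilleRotated`. [folklore] -/
theorem rss_futureVertexLiouvilleRotated_of_symmetricLiouville :
    Summit.NavierStokesRegularity.NavierStokesRegularity.Theses.SymmetryModuliCount.SymmetricLiouville →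
    ∀ (C : ℝ) (u : ℝ → EuclideanSpace ℝ (Fin 3) → EuclideanSpace ℝ (Fin 3)),
      Literature.Analysis.FluidPDE.IsTypeIAncientMild C u →
      ∀ (a : EuclideanSpace ℝ (Fin 3)) (σ : ℝ) (A : EuclideanSpace ℝ (Fin 3) →L[ℝ] EuclideanSpace ℝ (Fin 3)) (θ : ℝ),
        (∀ x, inner ℝ (A x) x = 0) → A ≠ 0 → σ ≠ 0 → 0 < θ →
        (∀ t < 0, ∀ x, fderiv ℝ (u t) x (a + σ • x + A x) + σ • u t x +
          (2 * σ * (t - θ)) • Literature.Analysis.FluidPDE.timeDeriv u t x - A (u t x) = 0) →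
        ∀ t < 0, ∀ x, u t x = 0 := by
  intro hSL C u hu a σ A θ hA _hA0 hσ hθ hgen
  have hd : DifferentiableOn ℝ (uncurry u) (Iio 0 ×ˢ univ) :=
    hu.contDiffOn.differentiableOn (by simp)
  -- centre and normalised rotation generator
  obtain ⟨xc, hxc⟩ := vertex_exists_center hσ hA a
  obtain ⟨B, hB_def⟩ : ∃ B : EuclideanSpace ℝ (Fin 3) →L[ℝ] EuclideanSpace ℝ (Fin 3), B = σ⁻¹ • A :=
    ⟨_, rfl⟩
  have hB : ∀ x, ⟪B x, x⟫ = 0 := fun x => by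
    rw [hB_def, smul_apply, real_inner_smul_left, hA x, mul_zero]
  have hgen' := rss_gen_normalise hσ hxc hB_def hgen
  -- the extension `v` of the forward shift `u(· + θ)`
  obtain ⟨v, hv_def⟩ : ∃ v : ℝ → EuclideanSpace ℝ (Fin 3) → EuclideanSpace ℝ (Fin 3), v = fun s y =>
      Real.exp (Real.log (Real.sqrt ((θ + 1) / (-s)))) •
        NormedSpace.exp ((-Real.log (Real.sqrt ((θ + 1) / (-s)))) • B)
          (u (θ + Real.exp (Real.log (Real.sqrt ((θ + 1) / (-s)))) ^ 2 * s)
            (xc + Real.exp (Real.log (Real.sqrt ((θ + 1) / (-s)))) •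
              NormedSpace.exp (Real.log (Real.sqrt ((θ + 1) / (-s))) • B) (y - xc))) := ⟨_, rfl⟩
  have hv : ∀ s y, v s y = Real.exp (Real.log (Real.sqrt ((θ + 1) / (-s)))) •
      NormedSpace.exp ((-Real.log (Real.sqrt ((θ + 1) / (-s)))) • B)
        (u (θ + Real.exp (Real.log (Real.sqrt ((θ + 1) / (-s)))) ^ 2 * s)
          (xc + Real.exp (Real.log (Real.sqrt ((θ + 1) / (-s)))) •
            NormedSpace.exp (Real.log (Real.sqrt ((θ + 1) / (-s))) • B) (y - xc))) :=
    fun s y => by rw [hv_def]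
  -- local agreement of `v` with every pull-back looking into the slab
  have hloc : ∀ (ρ s : ℝ) (y : EuclideanSpace ℝ (Fin 3)), θ + Real.exp ρ ^ 2 * s < 0 →
      v s y = Real.exp ρ • NormedSpace.exp ((-ρ) • B)
        (u (θ + Real.exp ρ ^ 2 * s) (xc + Real.exp ρ • NormedSpace.exp (ρ • B) (y - xc))) := by
    intro ρ s y hρs
    have he : 0 < Real.exp ρ ^ 2 := by positivity
    have hs : s < 0 := by
      by_contra hs0
      have : 0 ≤ Real.exp ρ ^ 2 * s := mul_nonneg he.le (not_lt.1 hs0)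
      linarith
    have h1 : θ + Real.exp (Real.log (Real.sqrt ((θ + 1) / (-s)))) ^ 2 * s < 0 := by
      rw [rss_anchor hθ hs]
      norm_num
    rw [hv s y]
    exact rss_pull_const hd hgen' y h1 hρs
  -- `v ∈ A_{2C}`
  have hvC : IsTypeIAncientMild (2 * C) v := by
    refine rss_isTypeIAncientMild_of_local fun t₁ ht₁ ε hε => ?_
    obtain ⟨ρ, hρ⟩ := rss_exists_small hθ (lt_min hε (neg_pos.2 ht₁))
    obtain ⟨G, hG, hGP⟩ := rss_exists_member hu hB θ xc ρ
    have he : 0 < Real.exp ρ ^ 2 := by positivity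
    have hρε : θ / Real.exp ρ ^ 2 < ε := hρ.trans_le (min_le_left _ _)
    have hρt : θ / Real.exp ρ ^ 2 < -t₁ := hρ.trans_le (min_le_right _ _)
    refine ⟨θ / Real.exp ρ ^ 2, G, by positivity, hρε, by linarith, hG, fun s hs y => ?_⟩
    rw [hGP s y]
    refine hloc ρ s y ?_
    rw [div_lt_iff₀ he] at hρt
    nlinarith
  -- the generator of `v`, anchored at vertex time `0`
  have hdv : DifferentiableOn ℝ (uncurry v) (Iio 0 ×ˢ univ) :=
    hvC.contDiffOn.differentiableOn (by simp)
  have hU : IsOpen (Iio (0 : ℝ) ×ˢ (univ : Set (EuclideanSpace ℝ (Fin 3)))) :=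
    isOpen_Iio.prod isOpen_univ
  have hgenv : ∀ s < 0, ∀ y, fderiv ℝ (v s) y (a + σ • y + A y) + σ • v s y +
      (2 * σ * s) • timeDeriv v s y - A (v s y) = 0 := by
    intro s hs y
    have hmem : (s, y) ∈ Iio (0 : ℝ) ×ˢ (univ : Set (EuclideanSpace ℝ (Fin 3))) := ⟨hs, mem_univ _⟩
    have hLv := ((hdv _ hmem).differentiableAt (hU.mem_nhds hmem)).hasFDerivAt
    exact rss_gen_denormalise hσ hxc hB_def (rss_ext_gen hd hθ hgen' hv hs hLv)
  -- `SymmetricLiouville` kills `v`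
  have hv0 : ∀ s < 0, ∀ y, v s y = 0 :=
    hSL (2 * C) v (isTypeIAncientMild_iff.1 hvC) a σ A hA (fun h => hσ h.2.1) hgenv
  -- and `u(t, ·) = v(t − θ, ·)`
  intro t ht x
  have h1 := hloc 0 (t - θ) x (by rw [Real.exp_zero, one_pow, one_mul]; linarith)
  rw [hv0 (t - θ) (by linarith) x, rss_pull_zero, add_sub_cancel] at h1
  exact h1.symm

end Summit.NavierStokesRegularity.NavierStokesRegularity.Theorems

end
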